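import Mathlib
import Summits.NavierStokesRegularity.NavierStokesRegularity.Theorems.TaoLadderRungTwoBreakBlowupRigidityOneExtinguishableCore
import HarnessLib

/-!
# The SINGLE-FEED PAIR: an explicit table of `E₂(1)` whose modes `{0, 1}` form a self-sustaining core that EMITS INTO
  ITSELF (so the outflow-live-core normal form of `…OutflowCore` does not settle it) but which is EXTINGUISHED two shells
  above any one-shell datum (`…ExtinguishableCore`): no robust blow-up at any scale ratio — the witness that the
  perpetual-core normal form (`…PerpetualCore`) strictly sharpens the outflow-live one, for K2(1)
  `TaoLadderRungTwoBreak.BlowupRigidityOne` (stmt-NavierStokesRegularity-20206; `--supports`)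

MODEL lattice ODEs only (Tao 2016 §4 (4.1)–(4.3), Thm. 4.2 statement shape); nothing here is a statement about the
Navier–Stokes equations; NO item is closed.  DEF-FREE (the table is displayed as a lambda in every statement);
ROUTE-INDEPENDENT MODULE (no `Theses` import).

THE TABLE (modes `a = 0`, `b = 1`; modes `2, 3` idle).  Feed `α_{01 0,(0,0,1)} = α_{10 0,(0,0,1)} = 1` — the monomial
`x_0 x_1` of shell `n−1` drives mode `0` of shell `n`; cross drain `α_{00 1,(0,1,0)} = α_{00 1,(1,0,0)} = −1` — the monomial
`x_{0,n} x_{0,n+1}` drives mode `1` of shell `n` (the single back-reaction partner of the feed,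
`outflow_single_partner_of_lt_two`); every other structure constant is `0`.  It is symmetric (4.2), cancelling (4.3)
(the only non-trivial orbit is `−1 + 1 + 0 = 0`) and `R`-comparable for every `R ≥ 1` (entries `0, ±1`), hence in `E₂(R)`
for all `R ≥ 1`.

* `isSymmetricCoeff_singleFeedPair`, `isCancellingCoeff_singleFeedPair`, `inTableClass_singleFeedPair`;
* `outflowCore_singleFeedPair` — `{0,1}` is a self-sustaining core (`0` is driven by the feed, `1` by the drain) containing
  the internal outflow monomial `x_0 x_1 ↦ y_0`: the hypothesis shape of `blowupRigidityOne_iff_outflowCore`;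
* `peelable_singleFeedPair` — the idle modes `2, 3` are peelable off `{0,1}` (they have no driver at all);
* `not_noGlobalCascade_singleFeedPair` — `¬ NoGlobalCascade ε₀ (single-feed pair) X₀` for EVERY `ε₀ > 0` and EVERY
  one-shell datum (`not_noGlobalCascade_pair_of_outflow_eq_zero` at `R = 1`: the cross feed into mode `1` vanishes).

HONEST LABEL: one explicit example settling where two normal forms differ; no stub, crux, rung or summit is proved; rung 0.
-/

noncomputable section

-- the summit and its single sub-problem share the name (CONVENTIONS §1)
set_option linter.dupNamespace false

namespace Summit.NavierStokesRegularity.NavierStokesRegularity.Theorems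

namespace BlowupRigidityOne

open Literature.Analysis.FluidPDE Literature.Analysis.FluidPDE.TaoCascade

/-- The single-feed pair table is symmetric (4.2). [cite: Tao2016AveragedNS, §4 (4.2); cell vocabulary (`IsSymmetricCoeff`)] -/
theorem isSymmetricCoeff_singleFeedPair :
    IsSymmetricCoeff (fun (i₁ i₂ i₃ : Fin 4) (μ : ℤ × ℤ × ℤ) =>
      if μ = ((0 : ℤ), (0 : ℤ), (1 : ℤ)) then
        (if ((i₁ = 0 ∧ i₂ = 1) ∨ (i₁ = 1 ∧ i₂ = 0)) ∧ i₃ = 0 then (1 : ℝ) else 0)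
      else if μ = ((1 : ℤ), (0 : ℤ), (0 : ℤ)) ∨ μ = ((0 : ℤ), (1 : ℤ), (0 : ℤ)) then
        (if i₁ = 0 ∧ i₂ = 0 ∧ i₃ = 1 then (-1 : ℝ) else 0)
      else 0) := by
  intro i₁ i₂ i₃ μ₁ μ₂ μ₃ hμ
  rw [mem_shiftSet_iff] at hμ
  simp only [Prod.mk.injEq] at hμ
  rcases hμ with ⟨rfl, rfl, rfl⟩ | ⟨rfl, rfl, rfl⟩ | ⟨rfl, rfl, rfl⟩ | ⟨rfl, rfl, rfl⟩ <;>
    fin_cases i₁ <;> fin_cases i₂ <;> fin_cases i₃ <;> norm_num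

/-- The single-feed pair table is cancelling (4.3): the only non-trivial cancellation orbit is
`α_{00 1,(0,1,0)} + α_{01 0,(0,0,1)} + α_{01 0,(1,0,0)} = −1 + 1 + 0`. [cite: Tao2016AveragedNS, §4 (4.3); cell vocabulary (`IsCancellingCoeff`)] -/
theorem isCancellingCoeff_singleFeedPair :
    IsCancellingCoeff (fun (i₁ i₂ i₃ : Fin 4) (μ : ℤ × ℤ × ℤ) =>
      if μ = ((0 : ℤ), (0 : ℤ), (1 : ℤ)) then
        (if ((i₁ = 0 ∧ i₂ = 1) ∨ (i₁ = 1 ∧ i₂ = 0)) ∧ i₃ = 0 then (1 : ℝ) else 0)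
      else if μ = ((1 : ℤ), (0 : ℤ), (0 : ℤ)) ∨ μ = ((0 : ℤ), (1 : ℤ), (0 : ℤ)) then
        (if i₁ = 0 ∧ i₂ = 0 ∧ i₃ = 1 then (-1 : ℝ) else 0)
      else 0) := by
  intro i₁ i₂ i₃ μ₁ μ₂ μ₃ hμ
  rw [mem_shiftSet_iff] at hμ
  simp only [Prod.mk.injEq] at hμ
  rcases hμ with ⟨rfl, rfl, rfl⟩ | ⟨rfl, rfl, rfl⟩ | ⟨rfl, rfl, rfl⟩ | ⟨rfl, rfl, rfl⟩ <;>
    fin_cases i₁ <;> fin_cases i₂ <;> fin_cases i₃ <;> norm_num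

/-- Every entry of the single-feed pair table is `0`, `1` or `−1`. [cite: Tao2016AveragedNS, §4 (4.1); cell vocabulary] -/
theorem singleFeedPair_values (i₁ i₂ i₃ : Fin 4) (μ : ℤ × ℤ × ℤ) :
    (fun (i₁ i₂ i₃ : Fin 4) (μ : ℤ × ℤ × ℤ) =>
      if μ = ((0 : ℤ), (0 : ℤ), (1 : ℤ)) then
        (if ((i₁ = 0 ∧ i₂ = 1) ∨ (i₁ = 1 ∧ i₂ = 0)) ∧ i₃ = 0 then (1 : ℝ) else 0)
      else if μ = ((1 : ℤ), (0 : ℤ), (0 : ℤ)) ∨ μ = ((0 : ℤ), (1 : ℤ), (0 : ℤ)) then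
        (if i₁ = 0 ∧ i₂ = 0 ∧ i₃ = 1 then (-1 : ℝ) else 0)
      else 0) i₁ i₂ i₃ μ = 0 ∨
    (fun (i₁ i₂ i₃ : Fin 4) (μ : ℤ × ℤ × ℤ) =>
      if μ = ((0 : ℤ), (0 : ℤ), (1 : ℤ)) then
        (if ((i₁ = 0 ∧ i₂ = 1) ∨ (i₁ = 1 ∧ i₂ = 0)) ∧ i₃ = 0 then (1 : ℝ) else 0)
      else if μ = ((1 : ℤ), (0 : ℤ), (0 : ℤ)) ∨ μ = ((0 : ℤ), (1 : ℤ), (0 : ℤ)) then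
        (if i₁ = 0 ∧ i₂ = 0 ∧ i₃ = 1 then (-1 : ℝ) else 0)
      else 0) i₁ i₂ i₃ μ = 1 ∨
    (fun (i₁ i₂ i₃ : Fin 4) (μ : ℤ × ℤ × ℤ) =>
      if μ = ((0 : ℤ), (0 : ℤ), (1 : ℤ)) then
        (if ((i₁ = 0 ∧ i₂ = 1) ∨ (i₁ = 1 ∧ i₂ = 0)) ∧ i₃ = 0 then (1 : ℝ) else 0)
      else if μ = ((1 : ℤ), (0 : ℤ), (0 : ℤ)) ∨ μ = ((0 : ℤ), (1 : ℤ), (0 : ℤ)) then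
        (if i₁ = 0 ∧ i₂ = 0 ∧ i₃ = 1 then (-1 : ℝ) else 0)
      else 0) i₁ i₂ i₃ μ = -1 := by
  dsimp only
  split_ifs <;> simp

/-- **The single-feed pair table lies in `E₂(R)` for every `R ≥ 1`** (in particular in the spread-one class, below the
dyadic spread). [cite: Tao2016AveragedNS, §4 (4.2)–(4.3), §6.1; cell vocabulary (`InTableClass`)] -/
theorem inTableClass_singleFeedPair {R : ℝ} (hR : 1 ≤ R) :
    InTableClass R (fun (i₁ i₂ i₃ : Fin 4) (μ : ℤ × ℤ × ℤ) =>
      if μ = ((0 : ℤ), (0 : ℤ), (1 : ℤ)) then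
        (if ((i₁ = 0 ∧ i₂ = 1) ∨ (i₁ = 1 ∧ i₂ = 0)) ∧ i₃ = 0 then (1 : ℝ) else 0)
      else if μ = ((1 : ℤ), (0 : ℤ), (0 : ℤ)) ∨ μ = ((0 : ℤ), (1 : ℤ), (0 : ℤ)) then
        (if i₁ = 0 ∧ i₂ = 0 ∧ i₃ = 1 then (-1 : ℝ) else 0)
      else 0) := by
  refine ⟨isSymmetricCoeff_singleFeedPair, isCancellingCoeff_singleFeedPair, fun i₁ i₂ i₃ μ _ => ?_⟩
  have hRinv : R⁻¹ ≤ 1 := inv_le_one_of_one_le₀ hR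
  rcases singleFeedPair_values i₁ i₂ i₃ μ with h | h | h <;> rw [h]
  · simp
  · exact ⟨by simp, Or.inr (by simpa using hRinv)⟩
  · exact ⟨by simp, Or.inr (by simpa using hRinv)⟩

/-- **`{0, 1}` IS AN OUTFLOW-LIVE CORE of the single-feed pair table**: mode `0` is driven by the feed `x_0 x_1 ↦ y_0`,
mode `1` by the drain `x_0 y_0 ↦ x_1`, and the feed is an internal outflow monomial — exactly the hypothesis shape of
`blowupRigidityOne_iff_outflowCore` / `target_iff_outflowCore`, which therefore do not settle this table.
[cite: Tao2016AveragedNS, §4 (4.1); cell vocabulary (self-sustaining core, outflow-live core)] -/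
theorem outflowCore_singleFeedPair :
    ∃ C : Finset (Fin 4),
      (∀ i ∈ C, ∃ μ ∈ shiftSet, ∃ j ∈ C, ∃ k ∈ C, (fun (i₁ i₂ i₃ : Fin 4) (μ : ℤ × ℤ × ℤ) =>
      if μ = ((0 : ℤ), (0 : ℤ), (1 : ℤ)) then
        (if ((i₁ = 0 ∧ i₂ = 1) ∨ (i₁ = 1 ∧ i₂ = 0)) ∧ i₃ = 0 then (1 : ℝ) else 0)
      else if μ = ((1 : ℤ), (0 : ℤ), (0 : ℤ)) ∨ μ = ((0 : ℤ), (1 : ℤ), (0 : ℤ)) then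
        (if i₁ = 0 ∧ i₂ = 0 ∧ i₃ = 1 then (-1 : ℝ) else 0)
      else 0) j k i μ ≠ 0) ∧
      ∃ i ∈ C, ∃ j ∈ C, ∃ k ∈ C, (fun (i₁ i₂ i₃ : Fin 4) (μ : ℤ × ℤ × ℤ) =>
      if μ = ((0 : ℤ), (0 : ℤ), (1 : ℤ)) then
        (if ((i₁ = 0 ∧ i₂ = 1) ∨ (i₁ = 1 ∧ i₂ = 0)) ∧ i₃ = 0 then (1 : ℝ) else 0)
      else if μ = ((1 : ℤ), (0 : ℤ), (0 : ℤ)) ∨ μ = ((0 : ℤ), (1 : ℤ), (0 : ℤ)) then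
        (if i₁ = 0 ∧ i₂ = 0 ∧ i₃ = 1 then (-1 : ℝ) else 0)
      else 0) j k i ((0 : ℤ), (0 : ℤ), (1 : ℤ)) ≠ 0 := by
  have h001 : ((0 : ℤ), (0 : ℤ), (1 : ℤ)) ∈ shiftSet := by simp [shiftSet]
  have h010 : ((0 : ℤ), (1 : ℤ), (0 : ℤ)) ∈ shiftSet := by simp [shiftSet]
  have h0 : (0 : Fin 4) ∈ ({0, 1} : Finset (Fin 4)) := by simp
  have h1 : (1 : Fin 4) ∈ ({0, 1} : Finset (Fin 4)) := by simp
  refine ⟨{0, 1}, fun i hi => ?_, 0, h0, 0, h0, 1, h1, by norm_num⟩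
  rw [Finset.mem_insert, Finset.mem_singleton] at hi
  rcases hi with rfl | rfl
  · exact ⟨_, h001, 0, h0, 1, h1, by norm_num⟩
  · exact ⟨_, h010, 0, h0, 0, h0, by norm_num⟩

/-- **The idle modes are peelable off the pair**: every driver of a mode outside `{0, 1}` vanishes, so condition (P)
holds with the zero ranking. [cite: Tao2016AveragedNS, §4 (4.1); cell vocabulary (peelable table)] -/
theorem peelable_singleFeedPair :
    ∀ μ ∈ shiftSet, ∀ j k i : Fin 4, i ∉ ({0, 1} : Finset (Fin 4)) →
      (fun (i₁ i₂ i₃ : Fin 4) (μ : ℤ × ℤ × ℤ) =>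
      if μ = ((0 : ℤ), (0 : ℤ), (1 : ℤ)) then
        (if ((i₁ = 0 ∧ i₂ = 1) ∨ (i₁ = 1 ∧ i₂ = 0)) ∧ i₃ = 0 then (1 : ℝ) else 0)
      else if μ = ((1 : ℤ), (0 : ℤ), (0 : ℤ)) ∨ μ = ((0 : ℤ), (1 : ℤ), (0 : ℤ)) then
        (if i₁ = 0 ∧ i₂ = 0 ∧ i₃ = 1 then (-1 : ℝ) else 0)
      else 0) j k i μ ≠ 0 →
      (j ∉ ({0, 1} : Finset (Fin 4)) ∧ (fun _ : Fin 4 => (0 : ℕ)) j < (fun _ : Fin 4 => (0 : ℕ)) i) ∨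
        (k ∉ ({0, 1} : Finset (Fin 4)) ∧ (fun _ : Fin 4 => (0 : ℕ)) k < (fun _ : Fin 4 => (0 : ℕ)) i) := by
  intro μ hμ j k i hi hne
  exfalso
  apply hne
  have hi0 : i ≠ 0 := fun h => hi (by rw [h]; simp)
  have hi1 : i ≠ 1 := fun h => hi (by rw [h]; simp)
  dsimp only
  rw [mem_shiftSet_iff] at hμ
  rcases hμ with rfl | rfl | rfl | rfl <;> simp [hi0, hi1]

/-- **THE SINGLE-FEED PAIR NEVER BLOWS UP ROBUSTLY**: for EVERY `ε₀ > 0` and EVERY one-shell datum,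
`¬ NoGlobalCascade ε₀ (single-feed pair) X₀` — the cross feed into mode `1` vanishes, so the internal chain
`{0,1} ⊋ {0} ⊋ ∅` extinguishes the table (`not_noGlobalCascade_pair_of_outflow_eq_zero` at spread `R = 1 < 2`).  Together
with `outflowCore_singleFeedPair` this separates the perpetual-core normal form from the outflow-live one.
[cite: Tao2016AveragedNS, §4 Thm. 4.2 (statement shape); cell vocabulary (`NoGlobalCascade`)] -/
theorem not_noGlobalCascade_singleFeedPair {ε₀ : ℝ} (hε : 0 < ε₀) (X₀ : Fin 4 → ℝ) :
    ¬ NoGlobalCascade ε₀ (fun (i₁ i₂ i₃ : Fin 4) (μ : ℤ × ℤ × ℤ) =>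
      if μ = ((0 : ℤ), (0 : ℤ), (1 : ℤ)) then
        (if ((i₁ = 0 ∧ i₂ = 1) ∨ (i₁ = 1 ∧ i₂ = 0)) ∧ i₃ = 0 then (1 : ℝ) else 0)
      else if μ = ((1 : ℤ), (0 : ℤ), (0 : ℤ)) ∨ μ = ((0 : ℤ), (1 : ℤ), (0 : ℤ)) then
        (if i₁ = 0 ∧ i₂ = 0 ∧ i₃ = 1 then (-1 : ℝ) else 0)
      else 0) X₀ :=
  not_noGlobalCascade_pair_of_outflow_eq_zero hε (inTableClass_singleFeedPair le_rfl) one_pos one_lt_two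
    (a := 0) (b := 1) (rank := fun _ => 0) peelable_singleFeedPair (by norm_num) X₀

end BlowupRigidityOne

end Summit.NavierStokesRegularity.NavierStokesRegularity.Theorems

end
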